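import Mathlib

/-!
# Sector transport of a half-filling anchor (K23): the bookkeeping behind Conjecture M′

Solo seat `solo-AtomisticToContinuum-blind`, conjunct `BoseEinsteinCondensation`; paper §12.8(8),
ATTEMPTS A143, CLAIMS C186–C188.  For hard-core lattice bosons let `N₀ n` be the zero-momentum
occupation of the `n`-particle sector ground state on a graph with `V = 2m` sites.  Conjecture M′
asserts that `n ↦ N₀ n` is CONCAVE (with `N₀ 0 = 0`).  This file checks the purely real-variable
consequence used in the paper: discrete concavity through the origin makes `N₀ n / n`
non-increasing, so a lower bound at ONE sector (the reflection-positivity anchor at half filling,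
`N₀ m ≥ 2c·m`) is transported to EVERY sector below it, `N₀ n ≥ 2c·n` for all `n ≤ m`, and the
particle–hole identity `N₀ (V-n) = N₀ n + 1 - 2n/V` carries it above half filling.

* `SectorTransport.incr_antitone`      — increments of a discretely concave sequence are antitone
  (concavity is the explicit hypothesis `∀ k, k+2 ≤ m → N (k+2) - N (k+1) ≤ N (k+1) - N k`);
* `SectorTransport.mul_incr_le`        — `n · (N₀ (j+1) - N₀ j) ≤ N₀ n` for `n ≤ j+1`;
* `SectorTransport.chord`              — `n · N₀ j ≤ j · N₀ n` for `n ≤ j ≤ m` (ratio monotone);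
* `SectorTransport.anchor_transport`   — `2c·m ≤ N₀ m` ⇒ `2c·n ≤ N₀ n` for every `n ≤ m`;
* `SectorTransport.above_half_filling` — with the particle–hole identity, a bound for `V - n`.

No physics is formalised: `N₀` is an arbitrary real sequence and concavity, the anchor and the
particle–hole identity are hypotheses.
-/

namespace Summit.AtomisticToContinuum.BoseEinsteinCondensation.Theorems

namespace SectorTransport

/- Discrete concavity of `N : ℕ → ℝ` on `[0, m]` — consecutive increments do not increase — is
spelled out as the hypothesis `hc : ∀ k, k + 2 ≤ m → N (k + 2) - N (k + 1) ≤ N (k + 1) - N k` in every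
statement (no auxiliary definition, so that the file is definition-free). -/

variable {N : ℕ → ℝ} {m : ℕ}

/-- Increments are antitone on `[0, m-1]`: for `a ≤ b` with `b + 1 ≤ m`,
`N (b+1) - N b ≤ N (a+1) - N a`. -/
theorem incr_antitone (hc : ∀ k, k + 2 ≤ m → N (k + 2) - N (k + 1) ≤ N (k + 1) - N k) {a b : ℕ} (hab : a ≤ b) (hb : b + 1 ≤ m) :
    N (b + 1) - N b ≤ N (a + 1) - N a := by
  induction b with
  | zero =>
    have : a = 0 := Nat.le_zero.mp hab
    subst this; exact le_refl _
  | succ b ih =>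
    rcases Nat.eq_or_lt_of_le hab with h | h
    · subst h; exact le_refl _
    · have hab' : a ≤ b := Nat.lt_succ_iff.mp h
      have hb' : b + 1 ≤ m := by omega
      have step : N (b + 2) - N (b + 1) ≤ N (b + 1) - N b := hc b (by omega)
      calc N (b + 1 + 1) - N (b + 1) = N (b + 2) - N (b + 1) := by ring_nf
        _ ≤ N (b + 1) - N b := step
        _ ≤ N (a + 1) - N a := ih hab' hb'

/-- `n` copies of a late increment are dominated by the sum of the first `n` increments:
`n · (N (j+1) - N j) ≤ N n - N 0` whenever `n ≤ j + 1 ≤ m`. -/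
theorem mul_incr_le (hc : ∀ k, k + 2 ≤ m → N (k + 2) - N (k + 1) ≤ N (k + 1) - N k) :
    ∀ {n j : ℕ}, n ≤ j + 1 → j + 1 ≤ m → (n : ℝ) * (N (j + 1) - N j) ≤ N n - N 0 := by
  intro n
  induction n with
  | zero => intro j _ _; simp
  | succ n ih =>
    intro j hnj hj
    have hnj' : n ≤ j := by omega
    have h1 : (n : ℝ) * (N (j + 1) - N j) ≤ N n - N 0 := ih (by omega) hj
    have h2 : N (j + 1) - N j ≤ N (n + 1) - N n := incr_antitone hc hnj' hj
    push_cast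
    linarith

/-- Ratio monotonicity in chord form: for `n ≤ j ≤ m`, `n · (N j - N 0) ≤ j · (N n - N 0)`. -/
theorem chord (hc : ∀ k, k + 2 ≤ m → N (k + 2) - N (k + 1) ≤ N (k + 1) - N k) {n : ℕ} :
    ∀ {j : ℕ}, n ≤ j → j ≤ m → (n : ℝ) * (N j - N 0) ≤ (j : ℝ) * (N n - N 0) := by
  intro j
  induction j with
  | zero =>
    intro hn _
    have : n = 0 := Nat.le_zero.mp hn
    subst this; simp
  | succ j ih =>
    intro hn hj
    rcases Nat.eq_or_lt_of_le hn with h | h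
    · rw [h]
    · have hn' : n ≤ j := Nat.lt_succ_iff.mp h
      have hA : (n : ℝ) * (N j - N 0) ≤ (j : ℝ) * (N n - N 0) := ih hn' (by omega)
      have hB : (n : ℝ) * (N (j + 1) - N j) ≤ N n - N 0 := mul_incr_le hc (by omega) hj
      push_cast
      nlinarith [hA, hB]

/-- **Anchor transport.** If `N` is discretely concave on `[0, m]` with `N 0 = 0` and the anchor
sector satisfies `2c·m ≤ N m`, then `2c·n ≤ N n` for every `n ≤ m`. -/
theorem anchor_transport (hc : ∀ k, k + 2 ≤ m → N (k + 2) - N (k + 1) ≤ N (k + 1) - N k) (h0 : N 0 = 0) {c : ℝ}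
    (hanchor : 2 * c * (m : ℝ) ≤ N m) {n : ℕ} (hn : n ≤ m) : 2 * c * (n : ℝ) ≤ N n := by
  rcases Nat.eq_zero_or_pos n with h | hpos
  · subst h; simp [h0]
  · have hch : (n : ℝ) * (N m - N 0) ≤ (m : ℝ) * (N n - N 0) := chord hc hn le_rfl
    rw [h0, sub_zero, sub_zero] at hch
    have hm : (0 : ℝ) < (m : ℝ) := by
      have : 0 < m := lt_of_lt_of_le hpos hn
      exact_mod_cast this
    have hn' : (0 : ℝ) < (n : ℝ) := by exact_mod_cast hpos
    -- n · N m ≤ m · N n and 2c m ≤ N m give 2c n m ≤ m N n, divide by m > 0.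
    have : 2 * c * (n : ℝ) * (m : ℝ) ≤ (m : ℝ) * N n := by nlinarith [hch, hanchor, hn'.le]
    nlinarith [this, hm]

/-- **Above half filling.** With `V = 2m`, the particle–hole identity
`N (V - n) = N n + 1 - 2n/V` turns the transported bound into
`N (V - n) ≥ 2c·n + 1 - 2n/V` for `n ≤ m`; in particular (`c ≤ 1`, `n ≤ m = V/2`) the condensate
number in the `(V-n)`-particle sector is at least `2c` times the number `n` of holes minus nothing:
`N (V - n) ≥ 2c·n` as soon as `n ≤ m` (since `1 - 2n/V ≥ 0`). -/
theorem above_half_filling (hc : ∀ k, k + 2 ≤ m → N (k + 2) - N (k + 1) ≤ N (k + 1) - N k) (h0 : N 0 = 0) {c : ℝ}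
    (hanchor : 2 * c * (m : ℝ) ≤ N m)
    (hph : ∀ n, n ≤ 2 * m → N (2 * m - n) = N n + 1 - 2 * (n : ℝ) / (2 * m : ℝ))
    {n : ℕ} (hn : n ≤ m) (hm : 0 < m) : 2 * c * (n : ℝ) ≤ N (2 * m - n) := by
  have ht : 2 * c * (n : ℝ) ≤ N n := anchor_transport hc h0 hanchor hn
  rw [hph n (by omega)]
  have hmR : (0 : ℝ) < (2 * m : ℝ) := by positivity
  have hfrac : 2 * (n : ℝ) / (2 * m : ℝ) ≤ 1 := by
    rw [div_le_one hmR]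
    have : (n : ℝ) ≤ (m : ℝ) := by exact_mod_cast hn
    linarith
  linarith

/-- Sanity instance: the SU(2)/ferromagnetic corner `N n = n (V + 1 - n)/V` (here `V = 2m` as a
real parameter `v > 0`) is discretely concave with constant second difference `-2/v`. -/
theorem fm_corner_concave (v : ℝ) (hv : 0 < v) (m : ℕ) :
    ∀ k, k + 2 ≤ m →
      ((k + 2 : ℕ) : ℝ) * (v + 1 - ((k + 2 : ℕ) : ℝ)) / v - ((k + 1 : ℕ) : ℝ) * (v + 1 - ((k + 1 : ℕ) : ℝ)) / v
        ≤ ((k + 1 : ℕ) : ℝ) * (v + 1 - ((k + 1 : ℕ) : ℝ)) / v - (k : ℝ) * (v + 1 - (k : ℝ)) / v := by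
  intro k _
  push_cast
  rw [div_sub_div_same, div_sub_div_same, div_le_div_iff_of_pos_right hv]
  nlinarith

end SectorTransport

end Summit.AtomisticToContinuum.BoseEinsteinCondensation.Theorems
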